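import Summits.Ventures.CertifiedManyBodySolver.Theorems.R2cGcSpinConsumer
import Literature.MathematicalPhysics.QuantumLattice.HubbardRectangularTorus
import Literature.MathematicalPhysics.QuantumLattice.HubbardJordanWigner
import HarnessLib

/-!
# Route `R2cOpenStripTangentLine` — GC tangent-line consumer, part III: the PRODUCER-SIDE (spin-side, column-major,
`μ = 0`) entry point `m3Upper_tp0_le_m18o25_of_columnMajorSpinFamily`

HONEST FRAMING: first certified bounds; not a superconductivity verdict; every number certified or labelled float.
NO NUMBER IS CLAIMED HERE: the leaf-valued theorem below is an implication from the data + sentence a producer's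
strip-cell certificate would assert (`proof.conditional` by design). Candidate written by the route pen (sr-mbsolver-var-7
g16) = §6 of `R2cGcTangentConsumer_candidate.lean` v2 (c350da1f118f14ed), rebased on the LANDED parts I–II
(`Theorems/R2cGcTangentConsumer.lean` p503310, `Theorems/R2cGcTangentConsumerLeaf.lean` p503612, hubbard-r2c-p1 g5), for a
prover to land verbatim as `Theorems/R2cGcTangentConsumerSpin.lean --supports stmt-Ventures-19262 --as helper`. Landed by
hubbard-r2c-p1 g5 with ONE change: the final step calls the route-independent ONE-object turnkey
`m3Upper_tp0_le_m18o25_of_gcDefectFamily` (`Theorems/R2cGcSpinConsumer.lean`) instead of part II's two-object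
`m3Upper_tp0_le_m18o25_of_gcDefectFamilies`, so that this file imports no route (`Theses`) file (theses-cone lint);
all statements are the pen's, byte-identical.

Content. The producers (block2 DMRG / TI strip cells, eng-1 `bd-strip-cell-v1`) enumerate the sites of a `W`-wide strip
COLUMN-MAJOR, `r = x·W + y`, i.e. in the lexicographic order of `Fin L ×ₗ Fin W` — whereas the route's boxes are
`hubbardOpenBoxTT' W L` on `Fin W ×ₗ Fin L`. The coordinate swap is a graph isomorphism of both open-box graphs, so the signed
orbital permutation `relabelVec` transports every quadratic form (`relabel_hamiltonian`, `relabel_mapEquiv_totalNumber`,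
`star_relabelVec_dotProduct`); the Jordan–Wigner dictionary (`JordanWigner.expect_eq`, `toSpin_totalNumber`) then moves the
sentence to spin-side vectors. The sink `m3Upper_tp0_le_m18o25_of_columnMajorSpinFamily` takes, for every `k ≥ 1`, a finite
family of spin vectors on the `(k·c) × W` box with the `μ = 0` energy sentence, the mean particle number pinned to
`(7/8)·W·c·k·S ± q·S` (`q` k-free) and the PLAIN bar `(E + Δ)/(W·c) ≤ -18/25`, and returns the rung leaf via the landed
`m3Upper_tp0_le_m18o25_of_gcDefectFamily` (one object, both number clauses; part III-a). What remains for the strip writer (K1-GATE «writer (ii)»; spec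
`HOME/sr-mbsolver-var-7/R2c-bc3/WRITER-II-SPEC.md`) is ONLY the explicit column-major spin form of
`toSpin (hubbardOpenBoxTT' L W 1 0 8)` as a super-site `bondSum` and the cell-window Bellman telescoping producing the three
inequalities for every `k`. No definition of record, no named fact, no numerical input. Sources: Jordan–Wigner as typed in
`HubbardJordanWigner.lean`; Ruelle, *Statistical Mechanics* (1969) §3.3–3.4 [Ruelle1969].
-/

noncomputable section

open Matrix Finset
open scoped ComplexOrder BigOperators

namespace Summit.Ventures.CertifiedManyBodySolver.Theorems

open Literature.MathematicalPhysics.QuantumLattice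
open Literature.MathematicalPhysics.QuantumLattice.ThermodynamicLimit
section Transport

variable {L a : ℕ}

/-- A coordinate swap `σ : (x, y) ↦ (y, x)` from the producers' column-major site order `Fin L ×ₗ Fin a` to the route's
`Fin a ×ₗ Fin L` (characterised by its two coordinate equations; the instance used below is
`(ofLex.trans (Equiv.prodComm (Fin L) (Fin a))).trans toLex`) is an isomorphism of the nearest-neighbour open-box graphs.
[folklore] -/
theorem rectBoxGraph_adj_swap (σ : (Fin L ×ₗ Fin a) ≃ (Fin a ×ₗ Fin L)) (h₁ : ∀ p, (ofLex (σ p)).1 = (ofLex p).2)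
    (h₂ : ∀ p, (ofLex (σ p)).2 = (ofLex p).1) (p q : Fin L ×ₗ Fin a) :
    (rectBoxGraph a L).Adj (σ p) (σ q) ↔ (rectBoxGraph L a).Adj p q := by
  show ((ofLex (σ p)).2 = (ofLex (σ q)).2 ∧ lineAdj (ofLex (σ p)).1 (ofLex (σ q)).1) ∨
      ((ofLex (σ p)).1 = (ofLex (σ q)).1 ∧ lineAdj (ofLex (σ p)).2 (ofLex (σ q)).2) ↔
    ((ofLex p).2 = (ofLex q).2 ∧ lineAdj (ofLex p).1 (ofLex q).1) ∨ ((ofLex p).1 = (ofLex q).1 ∧ lineAdj (ofLex p).2 (ofLex q).2)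
  rw [h₁, h₁, h₂, h₂]
  exact or_comm

/-- The swap is an isomorphism of the next-nearest-neighbour (diagonal) open-box graphs. [folklore] -/
theorem rectBoxDiagGraph_adj_swap (σ : (Fin L ×ₗ Fin a) ≃ (Fin a ×ₗ Fin L)) (h₁ : ∀ p, (ofLex (σ p)).1 = (ofLex p).2)
    (h₂ : ∀ p, (ofLex (σ p)).2 = (ofLex p).1) (p q : Fin L ×ₗ Fin a) :
    (rectBoxDiagGraph a L).Adj (σ p) (σ q) ↔ (rectBoxDiagGraph L a).Adj p q := by
  show (lineAdj (ofLex (σ p)).1 (ofLex (σ q)).1 ∧ lineAdj (ofLex (σ p)).2 (ofLex (σ q)).2) ↔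
    (lineAdj (ofLex p).1 (ofLex q).1 ∧ lineAdj (ofLex p).2 (ofLex q).2)
  rw [h₁, h₁, h₂, h₂]
  exact and_comm

/-- **The `t–t'` open-box Hamiltonian is covariant under the coordinate swap**:
`Γ_σ H(L × a) Γ_σ⁻¹ = H(a × L)`. [folklore] -/
theorem relabel_swap_hubbardOpenBoxTT' (σ : (Fin L ×ₗ Fin a) ≃ (Fin a ×ₗ Fin L)) (h₁ : ∀ p, (ofLex (σ p)).1 = (ofLex p).2)
    (h₂ : ∀ p, (ofLex (σ p)).2 = (ofLex p).1) (t t' U : ℝ) :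
    relabel (Orb.mapEquiv σ) (hubbardOpenBoxTT' L a t t' U) = hubbardOpenBoxTT' a L t t' U := by
  unfold hubbardOpenBoxTT'
  rw [map_add, relabel_hamiltonian (rectBoxGraph L a) (rectBoxGraph a L) σ (rectBoxGraph_adj_swap σ h₁ h₂),
    relabel_hamiltonian (rectBoxDiagGraph L a) (rectBoxDiagGraph a L) σ (rectBoxDiagGraph_adj_swap σ h₁ h₂)]

/-- Norms are preserved by the Fock vector `Γ_σ (JW⁻¹ φ)` behind a spin-side vector `φ` (inverse Jordan–Wigner map, then the
signed orbital permutation of the swap). [folklore] -/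
theorem star_relabelVec_toSpinVec_symm_dotProduct (σ : (Fin L ×ₗ Fin a) ≃ (Fin a ×ₗ Fin L))
    (φ : TensorIndex (Fin L ×ₗ Fin a) 4 → ℂ) :
    star (relabelVec (Orb.mapEquiv σ) (JordanWigner.toSpinVec.symm φ)) ⬝ᵥ
        relabelVec (Orb.mapEquiv σ) (JordanWigner.toSpinVec.symm φ) = star φ ⬝ᵥ φ := by
  rw [star_relabelVec_dotProduct, ← JordanWigner.star_toSpinVec_dotProduct, LinearEquiv.apply_symm_apply]

/-- The energy quadratic form is transported: `⟨Γ_σ JW⁻¹ φ, H(a × L) Γ_σ JW⁻¹ φ⟩ = ⟨φ, JW(H(L × a)) φ⟩`. [folklore] -/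
theorem star_relabelVec_toSpinVec_symm_dotProduct_hubbardOpenBoxTT'_mulVec (σ : (Fin L ×ₗ Fin a) ≃ (Fin a ×ₗ Fin L))
    (h₁ : ∀ p, (ofLex (σ p)).1 = (ofLex p).2) (h₂ : ∀ p, (ofLex (σ p)).2 = (ofLex p).1) (t t' U : ℝ)
    (φ : TensorIndex (Fin L ×ₗ Fin a) 4 → ℂ) :
    star (relabelVec (Orb.mapEquiv σ) (JordanWigner.toSpinVec.symm φ)) ⬝ᵥ
        (hubbardOpenBoxTT' a L t t' U *ᵥ relabelVec (Orb.mapEquiv σ) (JordanWigner.toSpinVec.symm φ)) =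
      star φ ⬝ᵥ (JordanWigner.toSpin (hubbardOpenBoxTT' L a t t' U) *ᵥ φ) := by
  rw [← relabel_swap_hubbardOpenBoxTT' σ h₁ h₂ t t' U, relabel_mulVec_relabelVec, star_relabelVec_dotProduct]
  have h := JordanWigner.expect_eq (hubbardOpenBoxTT' L a t t' U) (JordanWigner.toSpinVec.symm φ)
  rwa [Literature.MathematicalPhysics.QuantumLattice.expect, LinearEquiv.apply_symm_apply] at h

/-- The particle-number quadratic form is transported: `⟨Γ_σ JW⁻¹ φ, N̂ Γ_σ JW⁻¹ φ⟩ = ⟨φ, (Σ_x (n_↑ + n_↓)_x) φ⟩`. [folklore] -/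
theorem star_relabelVec_toSpinVec_symm_dotProduct_totalNumber_mulVec (σ : (Fin L ×ₗ Fin a) ≃ (Fin a ×ₗ Fin L))
    (φ : TensorIndex (Fin L ×ₗ Fin a) 4 → ℂ) :
    star (relabelVec (Orb.mapEquiv σ) (JordanWigner.toSpinVec.symm φ)) ⬝ᵥ
        (totalNumber *ᵥ relabelVec (Orb.mapEquiv σ) (JordanWigner.toSpinVec.symm φ)) =
      star φ ⬝ᵥ ((∑ x : Fin L ×ₗ Fin a, onSite x JordanWigner.siteTotalNumber) *ᵥ φ) := by
  rw [← relabel_mapEquiv_totalNumber σ, relabel_mulVec_relabelVec, star_relabelVec_dotProduct,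
    ← JordanWigner.toSpin_totalNumber]
  have h := JordanWigner.expect_eq (totalNumber (Λ := Fin L ×ₗ Fin a)) (JordanWigner.toSpinVec.symm φ)
  rwa [Literature.MathematicalPhysics.QuantumLattice.expect, LinearEquiv.apply_symm_apply] at h

end Transport


/-- **TURNKEY for ONE column-major spin-side strip object serving BOTH sides** (the sentence an exact `a = ∞` strip-cell
certificate with exact cell charge `(7/8)·W·c` yields after Bellman telescoping over `k` cells; `μ = 0`). DATA: width `W ≥ 1`,
cell length `c ≥ 1`, rationals `E, Δ, q` with the PLAIN bar `(E + Δ)/(W·c) ≤ -18/25`, and for every `k ≥ 1` a finite family of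
spin vectors `φ_l` on the `4^{k·c·W}`-dimensional spin space of `Fin (k·c) ×ₗ Fin W` (column-major JW order) with
`S = Σ‖φ_l‖² > 0`, the `μ = 0` energy sentence `Σ_l Re⟨φ_l, JW(H_open((k·c) × W; 1, 0, 8)) φ_l⟩ ≤ (kE + (k-1)Δ)·S`, and the mean
particle number pinned to `(7/8)·W·c·k·S` up to the k-FREE defect `q·S` on both sides. THEN the rung leaf
`e(1, 0, 8, 7/8) ≤ -18/25` holds — via the swap/JW transport above (the swap instantiated as `(ofLex.trans (Equiv.prodComm _ _)).trans toLex`), the conversion `E″ = E - (7/5)Wc + (8/5)q`,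
`Δ″ = Δ - (8/5)q` to the `μ = 8/5` sentence, and `m3Upper_tp0_le_m18o25_of_gcDefectFamily` (the same object serves both
one-sided GC families). [cite: Ruelle1969, §3.4] -/
theorem m3Upper_tp0_le_m18o25_of_columnMajorSpinFamily (W c : ℕ) (E Δ q : ℚ) (hW : 1 ≤ W) (hc : 1 ≤ c)
    (hE : (E + Δ) / ((W : ℚ) * (c : ℚ)) ≤ -18 / 25)
    (h : ∀ k : ℕ, 1 ≤ k → ∃ m : ℕ, ∃ φ : Fin m → (TensorIndex (Fin (k * c) ×ₗ Fin W) 4 → ℂ),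
        0 < ∑ l, (star (φ l) ⬝ᵥ φ l).re ∧
        ∑ l, (star (φ l) ⬝ᵥ (JordanWigner.toSpin (hubbardOpenBoxTT' (k * c) W 1 0 8) *ᵥ φ l)).re
          ≤ (((k : ℚ) * E + ((k : ℚ) - 1) * Δ : ℚ) : ℝ) * ∑ l, (star (φ l) ⬝ᵥ φ l).re ∧
        (((7 / 8 : ℚ) * ((W : ℚ) * (c : ℚ)) * (k : ℚ) - q : ℚ) : ℝ) * ∑ l, (star (φ l) ⬝ᵥ φ l).re
          ≤ ∑ l, (star (φ l) ⬝ᵥ ((∑ x : Fin (k * c) ×ₗ Fin W, onSite x JordanWigner.siteTotalNumber) *ᵥ φ l)).re ∧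
        ∑ l, (star (φ l) ⬝ᵥ ((∑ x : Fin (k * c) ×ₗ Fin W, onSite x JordanWigner.siteTotalNumber) *ᵥ φ l)).re
          ≤ (((7 / 8 : ℚ) * ((W : ℚ) * (c : ℚ)) * (k : ℚ) + q : ℚ) : ℝ) * ∑ l, (star (φ l) ⬝ᵥ φ l).re) :
    Summit.Ventures.CertifiedManyBodySolver.MbsolverRungLeaves.M3Upper_tp0_le_m18o25 := by
  have hWc : (0 : ℚ) < (W : ℚ) * (c : ℚ) := by exact_mod_cast Nat.mul_pos hW hc
  have hE'' : (E - 7 / 5 * ((W : ℚ) * (c : ℚ)) + 8 / 5 * q + (Δ - 8 / 5 * q)) / ((W : ℚ) * (c : ℚ)) ≤ -53 / 25 := by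
    rw [div_le_iff₀ hWc] at hE ⊢
    linarith
  -- the transported family, for every `k`, with the `μ = 8/5` sentence and both number clauses
  have hfam : ∀ k : ℕ, 1 ≤ k → ∃ m : ℕ, ∃ ψ : Fin m → Fock (Orb (Fin W ×ₗ Fin (k * c))),
      0 < ∑ l, (star (ψ l) ⬝ᵥ ψ l).re ∧
      ∑ l, (star (ψ l) ⬝ᵥ (hubbardOpenBoxTT' W (k * c) 1 0 8 *ᵥ ψ l)).re
          - (8 / 5 : ℝ) * ∑ l, (star (ψ l) ⬝ᵥ (totalNumber *ᵥ ψ l)).re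
        ≤ (((k : ℚ) * (E - 7 / 5 * ((W : ℚ) * (c : ℚ)) + 8 / 5 * q) + ((k : ℚ) - 1) * (Δ - 8 / 5 * q) : ℚ) : ℝ) *
          ∑ l, (star (ψ l) ⬝ᵥ ψ l).re ∧
      (((7 / 8 : ℚ) * ((W : ℚ) * (c : ℚ)) * (k : ℚ) - q : ℚ) : ℝ) * ∑ l, (star (ψ l) ⬝ᵥ ψ l).re
        ≤ ∑ l, (star (ψ l) ⬝ᵥ (totalNumber *ᵥ ψ l)).re ∧
      ∑ l, (star (ψ l) ⬝ᵥ (totalNumber *ᵥ ψ l)).re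
        ≤ (((7 / 8 : ℚ) * ((W : ℚ) * (c : ℚ)) * (k : ℚ) + q : ℚ) : ℝ) * ∑ l, (star (ψ l) ⬝ᵥ ψ l).re := by
    intro k hk
    obtain ⟨m, φ, hS, hH, hNlo, hNhi⟩ := h k hk
    -- the column-major ↔ route coordinate swap, kept abstract through its two coordinate equations
    obtain ⟨σ, h₁, h₂⟩ : ∃ σ : (Fin (k * c) ×ₗ Fin W) ≃ (Fin W ×ₗ Fin (k * c)),
        (∀ p, (ofLex (σ p)).1 = (ofLex p).2) ∧ (∀ p, (ofLex (σ p)).2 = (ofLex p).1) :=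
      ⟨(ofLex.trans (Equiv.prodComm (Fin (k * c)) (Fin W))).trans toLex, fun _ => rfl, fun _ => rfl⟩
    refine ⟨m, fun l => relabelVec (Orb.mapEquiv σ) (JordanWigner.toSpinVec.symm (φ l)), ?_, ?_, ?_, ?_⟩
    all_goals simp only [star_relabelVec_toSpinVec_symm_dotProduct,
      star_relabelVec_toSpinVec_symm_dotProduct_hubbardOpenBoxTT'_mulVec σ h₁ h₂,
      star_relabelVec_toSpinVec_symm_dotProduct_totalNumber_mulVec]
    · exact hS
    · push_cast at hH hNlo ⊢
      nlinarith [hH, hNlo]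
    · exact hNlo
    · exact hNhi
  exact m3Upper_tp0_le_m18o25_of_gcDefectFamily W c (E - 7 / 5 * ((W : ℚ) * (c : ℚ)) + 8 / 5 * q) (Δ - 8 / 5 * q) q
    hW hc hE'' hfam


end Summit.Ventures.CertifiedManyBodySolver.Theorems

end
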